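/-
Copyright (c) 2026. All rights reserved.
Released under Apache 2.0 license as described in the file LICENSE.
Authors: abc-iut cell — seat abc-iut-w4-d104 (gen 3): row «COR29-GLOBALISE» (L4-lead RULING #7e), the bridge
from the Cor 2.8 (b) charts of the interface to the chart-package hypothesis of
`ArchimedeanReconstructionCor29Globalise.lean`.
-/
import Literature.AnabelianGeometry.AbsoluteAnabelian.ArchimedeanReconstruction
import Mathlib.Analysis.Calculus.Deriv.Slope
import HarnessLib

/-!
# [AbsTopIII] Cor 2.9: the chart-package hypothesis is supplied by the Cor 2.8 (b) charts `f_U` and an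
# identification `κ : ℂ ≃ k_v`

S. Mochizuki, *Topics in absolute anabelian geometry III* (bib key `MochizukiAbsTopIII2015`), Cor 2.8 (b)
p.64 (the charts "`f_U : U_X ⥲ U_v`" of `X^top` defined by NF-rational functions) and Cor 2.9 pp.64–65.
PROOF-ONLY file (no definitions).  `ArchimedeanReconstructionCor29Globalise.lean` proves Cor 2.9 for the
genuine datum `D : NFCurveData` under a per-point **chart package** valued in `ℂ` (open `W ∋ x`,
`e : W ⥲ B(e x, r) ⊆ ℂ` with inverse `e'`) plus chart expressions and `κ : ℂ ≃+* k_v`.  Here: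

* `hasDerivAt_ringEquiv_conj`, `differentiableAt_ringEquiv_conj` — a `k_v`-differentiable chart expression
  `g` becomes the complex-differentiable `κ⁻¹ ∘ g ∘ κ` with derivative `κ⁻¹(g′)` (`κ` a ring isomorphism and
  a homeomorphism), so `k_v`-analytic expressions (Cor 2.8 (b): "locally … a convergent power series with
  coefficients in `k_v`") feed the `ℂ`-form of the hypothesis;
* `NFCurveData.exists_chartPackage_of_chart` — a Cor 2.8 (b) chart `c : D.Chart U_X` of the interface with
  `x ∈ U_X`, read through `κ⁻¹` and shrunk to a ball, IS a chart package at `x` (`e = κ⁻¹ ∘ f_U` on `W`).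

HONEST SCOPE: bookkeeping between typed interface notions; refereed pre-IUT material; nothing here bears on the
disputed [IUTchIII] Cor. 3.12; typed ≠ endorsed.
-/

noncomputable section

namespace Literature.AnabelianGeometry.AbsoluteAnabelian

open _root_.Set _root_.Topology _root_.Filter _root_.Metric _root_.Function _root_.TopologicalSpace

namespace ArchimedeanReconstruction

/-! ### Derivatives through an identification `κ : ℂ ≃ k_v` of topological fields -/

/-- If `g : k_v → k_v` has derivative `g'` at `κ z₀`, then its conjugate `κ⁻¹ ∘ g ∘ κ : ℂ → ℂ` has derivative
`κ⁻¹ g'` at `z₀` (`κ` a ring isomorphism and a homeomorphism): `k_v`-analytic chart expressions of the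
NF-rational functions are complex-differentiable chart expressions.
[cite: MochizukiAbsTopIII2015, Corollary 2.9 (a) p.65] -/
theorem hasDerivAt_ringEquiv_conj {𝕜 : Type*} [NontriviallyNormedField 𝕜] (κ : ℂ ≃+* 𝕜)
    (hκ : Continuous κ) (hκ' : Continuous κ.symm) {g : 𝕜 → 𝕜} {g' : 𝕜} {z₀ : ℂ}
    (hg : HasDerivAt g g' (κ z₀)) :
    HasDerivAt (fun z => κ.symm (g (κ z))) (κ.symm g') z₀ := by
  rw [hasDerivAt_iff_tendsto_slope] at hg ⊢
  -- `κ` maps the punctured neighbourhood filter of `z₀` into that of `κ z₀`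
  have hκt : Tendsto κ (𝓝[≠] z₀) (𝓝[≠] (κ z₀)) := by
    refine tendsto_nhdsWithin_iff.2 ⟨(hκ.tendsto z₀).mono_left nhdsWithin_le_nhds, ?_⟩
    refine eventually_nhdsWithin_of_forall fun z hz => ?_
    simp only [mem_compl_iff, mem_singleton_iff] at hz ⊢
    exact fun h => hz (κ.injective h)
  have h := ((hκ'.tendsto g').comp (hg.comp hκt))
  refine h.congr fun z => ?_
  simp only [Function.comp_apply, slope_def_field]
  rw [map_div₀, map_sub, map_sub, RingEquiv.symm_apply_apply, RingEquiv.symm_apply_apply]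

/-- Family form: `deriv` of the conjugate. [cite: MochizukiAbsTopIII2015, Corollary 2.9 (a) p.65] -/
theorem differentiableAt_ringEquiv_conj {𝕜 : Type*} [NontriviallyNormedField 𝕜] (κ : ℂ ≃+* 𝕜)
    (hκ : Continuous κ) (hκ' : Continuous κ.symm) {g : 𝕜 → 𝕜} {z₀ : ℂ}
    (hg : DifferentiableAt 𝕜 g (κ z₀)) :
    DifferentiableAt ℂ (fun z => κ.symm (g (κ z))) z₀ ∧
      deriv (fun z => κ.symm (g (κ z))) z₀ = κ.symm (deriv g (κ z₀)) :=
  ⟨(hasDerivAt_ringEquiv_conj κ hκ hκ' hg.hasDerivAt).differentiableAt,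
    (hasDerivAt_ringEquiv_conj κ hκ hκ' hg.hasDerivAt).deriv⟩

/-! ### From a Cor 2.8 (b) chart to a chart package -/

variable (D : NFCurveData)

open Classical in
/-- **A Cor 2.8 (b) chart yields a chart package**: given a chart `f_U : U_X ⥲ U_v ⊆ k_v` of `X^top`
(`NFCurveData.Chart`), an identification `κ : ℂ ≃ k_v` of topological fields and `x ∈ U_X`, there are an open
`W ∋ x`, a radius `r > 0` and maps `e : X^top → ℂ`, `e' : ℂ → X^top` with `e = κ⁻¹ ∘ f_U` on `W`, `e` a
homeomorphism `W ⥲ B(e x, r)` with inverse `e'` — the chart-package hypothesis of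
`NFCurveData.cor29Refined_of_chartPackage` at `x`. [cite: MochizukiAbsTopIII2015, Corollary 2.8 (b) p.64] -/
theorem NFCurveData.exists_chartPackage_of_chart {UX : Opens D.Xtop} (c : D.Chart UX) (κ : ℂ ≃+* D.kv)
    (hκ : Continuous κ) (hκ' : Continuous κ.symm) {x : D.Xtop} (hx : x ∈ UX) :
    ∃ (W : Set D.Xtop) (e : D.Xtop → ℂ) (e' : ℂ → D.Xtop) (r : ℝ), 0 < r ∧ IsOpen W ∧ x ∈ W ∧
      ContinuousOn e W ∧ MapsTo e W (ball (e x) r) ∧ ContinuousOn e' (ball (e x) r) ∧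
      MapsTo e' (ball (e x) r) W ∧ (∀ v ∈ W, e' (e v) = v) ∧ (∀ w ∈ ball (e x) r, e (e' w) = w) ∧
      ∀ v (hv : v ∈ UX), v ∈ W → κ (e v) = (c.fU ⟨v, hv⟩ : D.kv) := by
  -- the chart read through `κ⁻¹`, as total functions
  set E : D.Xtop → ℂ := fun v => if hv : v ∈ UX then κ.symm ((c.fU ⟨v, hv⟩ : c.Uv) : D.kv) else 0 with hE
  set E' : ℂ → D.Xtop := fun w => if hw : κ w ∈ c.Uv then ((c.fU.symm ⟨κ w, hw⟩ : UX) : D.Xtop) else x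
    with hE'
  have hEx : ∀ v (hv : v ∈ UX), E v = κ.symm ((c.fU ⟨v, hv⟩ : c.Uv) : D.kv) := fun v hv => by
    simp only [hE, hv, dite_true]
  -- a ball around `E x` inside `κ⁻¹(U_v)` (open: `κ.symm` is an open map, being a homeomorphism)
  have hopen : IsOpen ((fun w : ℂ => κ w) ⁻¹' (c.Uv : Set D.kv)) := c.Uv.isOpen.preimage hκ
  have hxmem : E x ∈ (fun w : ℂ => κ w) ⁻¹' (c.Uv : Set D.kv) := by
    show κ (E x) ∈ (c.Uv : Set D.kv)
    rw [hEx x hx, RingEquiv.apply_symm_apply]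
    exact (c.fU ⟨x, hx⟩).2
  obtain ⟨r, hr, hball⟩ := Metric.isOpen_iff.1 hopen (E x) hxmem
  set W : Set D.Xtop := {v | ∃ hv : v ∈ UX, E v ∈ ball (E x) r} with hW
  have hWsub : ∀ v, v ∈ W → v ∈ UX := fun v hv => hv.1
  -- continuity of `E` on `UX` (as a function on the subtype)
  have hEcont : Continuous (fun v : UX => E (v : D.Xtop)) := by
    have : (fun v : UX => E (v : D.Xtop)) = fun v => κ.symm ((c.fU v : c.Uv) : D.kv) := by
      funext v; rw [hEx v v.2]
    rw [this]
    exact hκ'.comp (continuous_subtype_val.comp c.fU.continuous)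
  have hE'x : ∀ w (hw : κ w ∈ c.Uv), E' w = ((c.fU.symm ⟨κ w, hw⟩ : UX) : D.Xtop) := fun w hw => by
    simp only [hE', hw, dite_true]
  -- `E ∘ E' = id` on `κ⁻¹(U_v)` and `E' ∘ E = id` on `U_X`
  have hEE' : ∀ w (hw : κ w ∈ c.Uv), E (E' w) = w := fun w hw => by
    rw [hE'x w hw, hEx _ (c.fU.symm ⟨κ w, hw⟩).2]
    have : c.fU ⟨((c.fU.symm ⟨κ w, hw⟩ : UX) : D.Xtop), (c.fU.symm ⟨κ w, hw⟩).2⟩ = ⟨κ w, hw⟩ := by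
      rw [Subtype.coe_eta, Homeomorph.apply_symm_apply]
    rw [this]
    exact κ.symm_apply_apply w
  have hE'E : ∀ v (hv : v ∈ UX), E' (E v) = v := fun v hv => by
    have hmem : κ (E v) ∈ c.Uv := by
      rw [hEx v hv, RingEquiv.apply_symm_apply]; exact (c.fU ⟨v, hv⟩).2
    rw [hE'x _ hmem]
    have : (⟨κ (E v), hmem⟩ : c.Uv) = c.fU ⟨v, hv⟩ := by
      apply Subtype.ext
      show κ (E v) = _
      rw [hEx v hv, RingEquiv.apply_symm_apply]
    rw [this, Homeomorph.symm_apply_apply]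
  refine ⟨W, E, E', r, hr, ?_, ⟨hx, mem_ball_self hr⟩, ?_, fun v hv => hv.2, ?_, ?_,
    fun v hv => hE'E v hv.1, fun w hw => hEE' w (hball hw), fun v hv _ => ?_⟩
  · -- `W` is open: the image under `Subtype.val` of an open subset of the open subtype `UX`
    have h1 : IsOpen ((fun v : UX => E (v : D.Xtop)) ⁻¹' ball (E x) r) := isOpen_ball.preimage hEcont
    have h2 := UX.isOpen.isOpenMap_subtype_val _ h1
    convert h2 using 1
    ext v
    simp only [hW, mem_setOf_eq, mem_image, mem_preimage, Subtype.exists, exists_and_right, exists_eq_right]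
    rfl
  · -- `E` is continuous on `W ⊆ UX`
    have hEU : ContinuousOn E (UX : Set D.Xtop) := continuousOn_iff_continuous_restrict.2 hEcont
    exact hEU.mono fun v hv => hWsub v hv
  · -- `E'` is continuous on the ball (there `κ w ∈ U_v`)
    have hb : ∀ w : ball (E x) r, κ (w : ℂ) ∈ c.Uv := fun w => hball w.2
    have hcont : Continuous (fun w : ball (E x) r => ((c.fU.symm ⟨κ (w : ℂ), hb w⟩ : UX) : D.Xtop)) :=
      continuous_subtype_val.comp (c.fU.symm.continuous.comp
        ((hκ.comp continuous_subtype_val).subtype_mk _))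
    refine continuousOn_iff_continuous_restrict.2 (hcont.congr fun w => ?_)
    exact (hE'x (w : ℂ) (hb w)).symm
  · -- `E'` maps the ball into `W`
    intro w hw
    have hwU : κ w ∈ c.Uv := hball hw
    refine ⟨by rw [hE'x w hwU]; exact (c.fU.symm ⟨κ w, hwU⟩).2, ?_⟩
    rw [hEE' w hwU]; exact hw
  · -- `κ ∘ E = f_U` on `U_X`
    rw [hEx v hv, RingEquiv.apply_symm_apply]

end ArchimedeanReconstruction

end Literature.AnabelianGeometry.AbsoluteAnabelian

end
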